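/-
Origin: expansion seat `planner-pub-hodgecm-mc-glue-1-g6-0`, handover #348 2026-08-19T15:52Z md5 69d036f23210166be1cf3053ccc40b6e (98 l.) NEW additive LIGHT leaf (J-Syl successor; model1-g6 WORD 15:07:17Z, theta-3-g8 POINTER 15:13:28Z): imports #339 `Model/Junction/SylvesterFrame` + vendored `UnitaryGroupArchIsotropy`, `UnitBallBounds`; decls `HodgeCM.Model.smul_x₀_eq_of_diagonal`, `HermSpace3.map_rationalFrame` (rfl), `HermSpace3.rationalToArch_mem_archIsotropy_of_map_eq` (γ^{ι₁} = G·diag(u)·G⁻¹ ⇒ γ⊗1 ∈ archIsotropy L V.Hm ι₁ V.sylvesterFrame hT), `…_of_eq` (γ = g·diag(u)·g⁻¹ in GL₃(L)); `hT` a variable (formCongr currency). Independent of #342–#347 (touches no `Level`); needs #338/#339 only; RUN 36 if (d) allows, else RUN 37. (`HOME/mc/pub-hodgecm-mc-glue-1-g6/lean/jsyl/HodgeCM/Model/Junction/SylvesterFrameIsotropy.lean`, md5 69d036f2, 98 lines);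
landed by the gen-12 packager (p-g12) in gate run 36 as `HodgeCM/Model/Junction/SylvesterFrameIsotropy.lean` (verbatim).
-/
/-
Origin: construction-prover seat `planner-pub-hodgecm-mc-glue-1-g6-0` (unit pub-hodgecm-mc-glue-1-g6, node E / (J-Syl)
custody), 2026-08-19 (NEW PKG LIGHT leaf; model1-g6 WORD 15:07:17Z «SUCCESSOR LEAF», theta-3-g8 POINTER 15:13:28Z;
imports #339 `Model/Junction/SylvesterFrame` (REPLACE, RUN 36) and the vendored arch-side projection / isotropy group;
nothing of the pin / `EmbInstance` / E). Kernel only; no E binder; MODEL-N ±0.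
-/
import Summits.HodgeConjecture.HodgeCM.Model.Junction.SylvesterFrame
import Literature.NumberTheory.Automorphic.UnitaryGroupArchIsotropy
import Literature.Geometry.ComplexHyperbolic.UnitBallBounds

/-!
# (J-Syl) The rational-diagonal torus lies in the archimedean isotropy group of the Sylvester frame

For a hermitian 3-space `V` over the CM field `L` with distinguished embedding `ι₁`, let `G = V.rationalFrameC ∈ GL₃(ℂ)`
be the `ι₁`-image of the rational orthogonal frame (`Model/Junction/RationalFrame`, `gᴴ H g = diag(d)`), `T = V.sylvesterFrame`
the uniform Sylvester frame (`Tᴴ ι₁(H) T = diag(1,1,-1)`, `Model/Junction/SylvesterFrame`), `π_{ι₁} : U(H)(L ⊗ ℝ) →* U(2,1)` the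
archimedean projection in the frame `T` (vendored `archProjU21EmbCM`, `π_{ι₁}(γ ⊗ 1) = T⁻¹ · γ^{ι₁} · T`) and
`K_∞ = π_{ι₁}⁻¹(Stab x₀)` the archimedean isotropy group (vendored `UnitaryGroup.archIsotropy`).

* `Model.smul_x₀_eq_of_diagonal` : a DIAGONAL element of `U(2,1)` fixes the base point `x₀ = 0` of the ball.
* `HermSpace3.rationalToArch_mem_archIsotropy_of_map_eq` : if `γ ∈ U(H)(L⁺)` reads `γ^{ι₁} = G · diag(u) · G⁻¹` in `GL₃(ℂ)`,
  then `γ ⊗ 1 ∈ K_∞` — by #339's `sylvesterFrame_conj_rationalTorus` (`T⁻¹ (G diag(u) G⁻¹) T = diag(u ∘ σ)`) and the first item.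
* `HermSpace3.rationalToArch_mem_archIsotropy_of_eq` : the same with the hypothesis over `L`: `γ = g · diag(u) · g⁻¹` in `GL₃(L)`,
  `g = V.rationalFrame` (the rational-diagonal torus `g · D · g⁻¹ ∩ U(H)(L⁺)`, in particular the CM torus `U(1)³ ⊂ U(diag d)`).

This is the one junction fact «`T_diag(L⁺)_{ι₁} ⊂ K_∞`» consumed by theta-3's theta-space pin (`K₁ = Stab x₀` in the uniform
frame) and by unitary-1's `WmInstanceV2`; the frame hypothesis `hT` (in the `formCongr` currency of `archIsotropy`) is a variable —
consumers instantiate it (e.g. from `Model.sylvesterFrame_J : Tᴴ · Hm^{ι₁} · T = J`, the same matrix identity; any proof is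
interchangeable by proof irrelevance).
-/

noncomputable section

open NumberField MulAction
open Literature.Geometry.ComplexHyperbolic Literature.Geometry.ComplexHyperbolic.BallModel
open Literature.NumberTheory.Automorphic

namespace HodgeCM

namespace Model

/-- A diagonal element of `U(2,1)` fixes the base point `x₀ = 0` of the ball (`(g · 0)ᵢ = g_{i2} / g_{22}`). [folklore] -/
theorem smul_x₀_eq_of_diagonal {g : U21} {u : Fin 3 → ℂ} (hg : mat g = Matrix.diagonal u) : g • x₀ = x₀ :=
  Ball.ext fun i => by
    have hi : Fin.castSucc i ≠ (2 : Fin 3) := by fin_cases i <;> decide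
    rw [smul_x₀_val, hg, Matrix.diagonal_apply_ne _ hi, zero_div, x₀_val, Pi.zero_apply]

end Model

namespace HermSpace3

variable {L : CMField} {ι₁ : L →+* ℂ} (V : HermSpace3 L ι₁)
  (hT : formCongr (starRingEnd ℂ) V.sylvesterFrame (V.Hm.map ι₁) = BallModel.J)

/-- `GL₃(ι₁)` of the rational frame is the rational frame at `ι₁`. -/
theorem map_rationalFrame : Matrix.GeneralLinearGroup.map ι₁ V.rationalFrame = V.rationalFrameC := rfl

/-- **(J-Syl) `T_diag(L⁺)_{ι₁} ⊂ K_∞`, `GL₃(ℂ)` form.** If a rational point `γ ∈ U(H)(L⁺)` is diagonal in the rational frame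
at `ι₁` — `γ^{ι₁} = G · diag(u) · G⁻¹`, `G = V.rationalFrameC` — then `γ ⊗ 1` lies in the archimedean isotropy group of the
Sylvester frame: `π_{ι₁}(γ ⊗ 1) = T⁻¹ γ^{ι₁} T = diag(u ∘ σ)` (#339 `sylvesterFrame_conj_rationalTorus`) fixes `x₀`. -/
theorem rationalToArch_mem_archIsotropy_of_map_eq
    (γ : UnitaryGroup.rational (↥(maximalRealSubfield L)) L (IsCMField.complexConj L) 3 V.Hm) (u : Fin 3 → ℂ)
    (hγ : ((Matrix.GeneralLinearGroup.map ι₁ (γ : GL (Fin 3) L) : GL (Fin 3) ℂ) : Matrix (Fin 3) (Fin 3) ℂ) =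
      (V.rationalFrameC : Matrix (Fin 3) (Fin 3) ℂ) * Matrix.diagonal u *
        ((V.rationalFrameC⁻¹ : GL (Fin 3) ℂ) : Matrix (Fin 3) (Fin 3) ℂ)) :
    UnitaryGroup.rationalToArch (↥(maximalRealSubfield L)) L (IsCMField.complexConj L) 3 V.Hm γ ∈
      UnitaryGroup.archIsotropy L V.Hm ι₁ V.sylvesterFrame hT := by
  rw [UnitaryGroup.mem_archIsotropy_iff]
  refine Model.smul_x₀_eq_of_diagonal (u := u ∘ V.rationalFramePerm) ?_
  show (((UnitaryGroup.archProjU21EmbCM L V.Hm ι₁ V.sylvesterFrame hT _ : U21) : GL (Fin 3) ℂ) :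
      Matrix (Fin 3) (Fin 3) ℂ) = _
  rw [UnitaryGroup.coe_archProjU21EmbCM_rationalToArch, Units.val_mul, Units.val_mul, hγ]
  exact V.sylvesterFrame_conj_rationalTorus u

/-- **(J-Syl) `T_diag(L⁺)_{ι₁} ⊂ K_∞`, `GL₃(L)` form.** If `γ ∈ U(H)(L⁺)` is diagonal in the rational orthogonal frame —
`γ = g · diag(u) · g⁻¹` in `GL₃(L)`, `g = V.rationalFrame` (the rational-diagonal torus; in particular the CM torus
`U(1)³ ⊂ U(diag d)`) — then `γ ⊗ 1 ∈ K_∞` for the Sylvester frame. -/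
theorem rationalToArch_mem_archIsotropy_of_eq
    (γ : UnitaryGroup.rational (↥(maximalRealSubfield L)) L (IsCMField.complexConj L) 3 V.Hm) (u : Fin 3 → L)
    (hγ : ((γ : GL (Fin 3) L) : Matrix (Fin 3) (Fin 3) L) =
      (V.rationalFrame : Matrix (Fin 3) (Fin 3) L) * Matrix.diagonal u *
        ((V.rationalFrame⁻¹ : GL (Fin 3) L) : Matrix (Fin 3) (Fin 3) L)) :
    UnitaryGroup.rationalToArch (↥(maximalRealSubfield L)) L (IsCMField.complexConj L) 3 V.Hm γ ∈
      UnitaryGroup.archIsotropy L V.Hm ι₁ V.sylvesterFrame hT := by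
  refine V.rationalToArch_mem_archIsotropy_of_map_eq hT γ (ι₁ ∘ u) ?_
  have hinv : ((V.rationalFrameC⁻¹ : GL (Fin 3) ℂ) : Matrix (Fin 3) (Fin 3) ℂ) =
      (((V.rationalFrame⁻¹ : GL (Fin 3) L) : Matrix (Fin 3) (Fin 3) L)).map ι₁ := by
    rw [← map_rationalFrame, ← map_inv]; rfl
  have hmap : ((Matrix.GeneralLinearGroup.map ι₁ (γ : GL (Fin 3) L) : GL (Fin 3) ℂ) : Matrix (Fin 3) (Fin 3) ℂ) =
      (((γ : GL (Fin 3) L)) : Matrix (Fin 3) (Fin 3) L).map ι₁ := rfl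
  rw [hmap, hγ, Matrix.map_mul, Matrix.map_mul, Matrix.diagonal_map (map_zero ι₁), hinv, coe_rationalFrameC]
  rfl

end HermSpace3

end HodgeCM

end
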